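/-
Origin: expansion seat `planner-pub-hodgecm-pv13-0`, handover 2026-08-18T04:15:16Z / repoint 04:17:06Z (`HOME/pub-hodgecm-pv13/lean/Pv13/LiftExtension.lean`, md5 b53fc3e3, 154 lines);
landed by the gen-5 packager in gate run 21 as `HodgeCM/PerL34/LiftExtension.lean` (verbatim).
-/
/-
Origin: pub-hodgecm-pv13 (DAG-NODE PROVER #13) — answer to referee objection adv2g3-O1 (GAPS.md, 04:11Z):
the BOUNDED `G∞`-intertwiners `lift j : V → L²` of `ConstituentSplit.ConstituentDictionary` (r2′) are not
"definition of the theta kernel" — boundedness is a consequence of a NORM INEQUALITY on a dense `G∞`-stable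
subspace (the Schwartz / K-finite isotypic vectors), itself DERIVED from N31e (Rallis' formula for general φ) and
N31f (compact factor).  This file is the KERNEL half: extension by density + equivariance of the extension.
Imports LANDED `HodgeCM.PerL34.SchurUnitary` (run 20) and Mathlib.  Proposed place:
`HodgeCM/PerL34/LiftExtension.lean`, namespace `HodgeCM.PerL34.Schur`.  Nothing cited, nothing asserted.
-/
import Summits.HodgeConjecture.HodgeCM.PerL34.SchurUnitary
import Mathlib.Analysis.Normed.Operator.Extend

set_option autoImplicit false

/-!
# Bounded equivariant extension of a densely defined lift (adv2g3-O1)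

`DenseLift ρ τ` packages, for unitary representations `ρ` of `G` on `W` and `τ` on `H`:
a dense `ρ`-stable subspace `S ≤ W` [(D5) Schwartz vectors of the isotypic piece], a linear map
`θ₀ : S →ₗ[ℂ] H` [(D2) the theta lift `v ↦ θ(v ⊗ φ_f, χ')` on Schwartz vectors], `ρ/τ`-equivariant on `S`
[(D2) automorphy of the theta kernel], and a norm bound `‖θ₀ v‖ ≤ C‖v‖` [(r2′-an): DERIVED from N31e + N31f —
`‖θ(v ⊗ φ_f, χ')‖² = c·vol·I_f(φ_f)·vol_∞·‖v‖²` by `RallisUnfold.rallis_inner_product_formula` (general φ) and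
`CompactFactor`; a labelled field over this abstract shell, which does not see `[G_U]`].
KERNEL: `DenseLift.lift : W →L[ℂ] H` (unique bounded extension, `ContinuousLinearMap.extend`), `lift_apply`
(agrees with `θ₀` on `S`), `lift_intertwines : Schur.Intertwines ρ τ lift` (equivariance passes to the closure),
`range_θ₀_le` (the Schwartz lifts lie in the range).
-/

noncomputable section

open Unitary

namespace HodgeCM
namespace PerL34
namespace Schur

variable {G : Type*} [Group G]
variable {W : Type*} [NormedAddCommGroup W] [InnerProductSpace ℂ W] [CompleteSpace W]
variable {H : Type*} [NormedAddCommGroup H] [InnerProductSpace ℂ H] [CompleteSpace H]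

/-- A densely defined, equivariant, norm-bounded lift (see the module docstring for the label of each field). -/
structure DenseLift (ρ : G →* unitary (W →L[ℂ] W)) (τ : G →* unitary (H →L[ℂ] H)) where
  /-- (D5) the dense subspace of "Schwartz" vectors … -/
  S : Submodule ℂ W
  dense : Dense (S : Set W)
  /-- … stable under `ρ` (the Weil representation preserves Schwartz vectors; `G∞` commutes with `U(W)∞`) -/
  inv : ∀ g : G, ∀ v ∈ S, (ρ g : W →L[ℂ] W) v ∈ S
  /-- (D2) the lift on Schwartz vectors … -/
  θ₀ : S →ₗ[ℂ] H
  /-- … equivariant (automorphy of the theta kernel) -/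
  equivariant : ∀ (g : G) (v : S), θ₀ ⟨(ρ g : W →L[ℂ] W) v, inv g v v.2⟩ = (τ g : H →L[ℂ] H) (θ₀ v)
  /-- (r2′-an) DERIVED from N31e + N31f: the norm bound (in fact `‖θ₀ v‖² = C'‖v‖²`) -/
  C : ℝ
  norm_le : ∀ v : S, ‖θ₀ v‖ ≤ C * ‖v‖

namespace DenseLift

variable {ρ : G →* unitary (W →L[ℂ] W)} {τ : G →* unitary (H →L[ℂ] H)} (Λ : DenseLift ρ τ)

/-- `θ₀` as a bounded operator on `S`. -/
def θ₀L : Λ.S →L[ℂ] H := Λ.θ₀.mkContinuous Λ.C Λ.norm_le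

/-- (Ported verbatim from the HodgeCMPerL package; no docstring in the source.) -/
@[simp] theorem θ₀L_apply (v : Λ.S) : Λ.θ₀L v = Λ.θ₀ v := rfl

/-- (Ported verbatim from the HodgeCMPerL package; no docstring in the source.) -/
theorem denseRange_subtypeL : DenseRange (Λ.S.subtypeL : Λ.S → W) := Λ.dense.denseRange_val

/-- (Ported verbatim from the HodgeCMPerL package; no docstring in the source.) -/
theorem isUniformInducing_subtypeL : IsUniformInducing (Λ.S.subtypeL : Λ.S → W) :=
  isUniformEmbedding_subtype_val.isUniformInducing

/-- **The bounded lift**: the unique continuous extension of `θ₀` to `W`. -/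
def lift : W →L[ℂ] H := Λ.θ₀L.extend Λ.S.subtypeL

/-- It agrees with `θ₀` on Schwartz vectors. -/
@[simp] theorem lift_apply (v : Λ.S) : Λ.lift (v : W) = Λ.θ₀ v := by
  have h := Λ.θ₀L.extend_eq Λ.denseRange_subtypeL Λ.isUniformInducing_subtypeL v
  simpa [lift] using h

/-- **Equivariance passes to the closure**: `lift ∘ ρ(g) = τ(g) ∘ lift`. -/
theorem lift_intertwines : Intertwines ρ τ Λ.lift := by
  intro g
  apply ContinuousLinearMap.coeFn_injective
  refine Continuous.ext_on Λ.dense (ContinuousLinearMap.continuous _) (ContinuousLinearMap.continuous _) ?_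
  intro v hv
  have h1 : Λ.lift ((ρ g : W →L[ℂ] W) v) = Λ.θ₀ ⟨(ρ g : W →L[ℂ] W) v, Λ.inv g v hv⟩ :=
    Λ.lift_apply ⟨(ρ g : W →L[ℂ] W) v, Λ.inv g v hv⟩
  have h2 : Λ.lift v = Λ.θ₀ ⟨v, hv⟩ := Λ.lift_apply ⟨v, hv⟩
  simp only [ContinuousLinearMap.coe_comp, Function.comp_apply]
  rw [h1, h2]
  exact Λ.equivariant g ⟨v, hv⟩

/-- The Schwartz lifts lie in the range of the bounded lift. -/
theorem range_θ₀_le : LinearMap.range Λ.θ₀ ≤ LinearMap.range Λ.lift.toLinearMap := by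
  rintro _ ⟨v, rfl⟩
  exact ⟨(v : W), Λ.lift_apply v⟩

/-- **Constructor from the producers' shape**: N31e + N31f give the SQUARED-norm identity
`‖θ(v ⊗ φ_f, χ')‖² = C'·‖v‖²` (`C' = c·vol·I_f(φ_f)·vol_∞ ≥ 0`); this yields the norm bound with `C = √C'`. -/
def ofNormSq (S : Submodule ℂ W) (dense : Dense (S : Set W))
    (inv : ∀ g : G, ∀ v ∈ S, (ρ g : W →L[ℂ] W) v ∈ S) (θ₀ : S →ₗ[ℂ] H)
    (equivariant : ∀ (g : G) (v : S), θ₀ ⟨(ρ g : W →L[ℂ] W) v, inv g v v.2⟩ = (τ g : H →L[ℂ] H) (θ₀ v))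
    (C' : ℝ) (normSq : ∀ v : S, ‖θ₀ v‖ ^ 2 = C' * ‖v‖ ^ 2) : DenseLift ρ τ where
  S := S
  dense := dense
  inv := inv
  θ₀ := θ₀
  equivariant := equivariant
  C := Real.sqrt C'
  norm_le v := le_of_eq (by
    rw [← Real.sqrt_sq (norm_nonneg (θ₀ v)), normSq v, Real.sqrt_mul' _ (sq_nonneg _),
      Real.sqrt_sq (norm_nonneg _)])

/-- In the `ofNormSq` shape the bounded lift is a MULTIPLE OF AN ISOMETRY on norms: `‖lift x‖² = C'‖x‖²` on all
of `W` (continuity + density). -/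
theorem ofNormSq_normSq (S : Submodule ℂ W) (dense : Dense (S : Set W))
    (inv : ∀ g : G, ∀ v ∈ S, (ρ g : W →L[ℂ] W) v ∈ S) (θ₀ : S →ₗ[ℂ] H)
    (equivariant : ∀ (g : G) (v : S), θ₀ ⟨(ρ g : W →L[ℂ] W) v, inv g v v.2⟩ = (τ g : H →L[ℂ] H) (θ₀ v))
    (C' : ℝ) (normSq : ∀ v : S, ‖θ₀ v‖ ^ 2 = C' * ‖v‖ ^ 2) (x : W) :
    ‖(ofNormSq (ρ := ρ) (τ := τ) S dense inv θ₀ equivariant C' normSq).lift x‖ ^ 2 = C' * ‖x‖ ^ 2 := by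
  set Λ := ofNormSq (ρ := ρ) (τ := τ) S dense inv θ₀ equivariant C' normSq
  have hcl : IsClosed {x : W | ‖Λ.lift x‖ ^ 2 = C' * ‖x‖ ^ 2} :=
    isClosed_eq ((continuous_norm.comp Λ.lift.continuous).pow 2) ((continuous_norm.pow 2).const_smul C' |>.congr
      fun _ => by simp [smul_eq_mul])
  have hS : (S : Set W) ⊆ {x : W | ‖Λ.lift x‖ ^ 2 = C' * ‖x‖ ^ 2} := fun v hv => by
    show ‖Λ.lift v‖ ^ 2 = C' * ‖v‖ ^ 2
    have := Λ.lift_apply ⟨v, hv⟩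
    rw [this]; exact normSq ⟨v, hv⟩
  exact hcl.closure_subset_iff.mpr hS (by rw [dense.closure_eq]; exact Set.mem_univ x)

end DenseLift

/-! ### Non-vacuity: the identity lift on the whole space -/

namespace DenseLift

/-- For `τ = ρ`, `S = ⊤`, `θ₀ = inclusion`: a `DenseLift ρ ρ` (used by the Smoke dictionary). -/
def top (ρ : G →* unitary (W →L[ℂ] W)) : DenseLift ρ ρ where
  S := ⊤
  dense := by rw [Submodule.top_coe]; exact dense_univ
  inv _ _ _ := Submodule.mem_top
  θ₀ := (⊤ : Submodule ℂ W).subtype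
  equivariant _ _ := rfl
  C := 1
  norm_le v := by rw [one_mul]; exact le_rfl

/-- (Ported verbatim from the HodgeCMPerL package; no docstring in the source.) -/
@[simp] theorem top_lift_apply (ρ : G →* unitary (W →L[ℂ] W)) (x : W) : (top ρ).lift x = x :=
  (top ρ).lift_apply ⟨x, Submodule.mem_top⟩

end DenseLift

end Schur
end PerL34
end HodgeCM

end
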